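/-
Copyright (c) 2026 the pub-hodgecm-mathlib formalisation cell (harness21).  Prover seat hodgecm-mathlib-LH4-p14 (g8), Track B «K2-LIT», #184♮ = hLiu418 =
`stmt-HodgeConjecture-24832`; socket #41, KIND 1, K1-b♮ line-term chain — the `blk ↔ archAt` LEVI DICTIONARY at the tube frames of record (K2 bus 2026-09-05T02:52Z).
THEOREMS ONLY (no `def`, no `instance`, no notation, no named-fact hypothesis, no `sorry`, default heartbeats).
-/
import Summits.HodgeConjecture.HodgeConjecture.Theorems.K2LiuSiegelDoubledRationalPoints   -- ★ `map_cayR`, `map_cayRinv`, `map_conj_fromBlocks`, `map_cstar`, `gramRL_facts`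
import Summits.HodgeConjecture.HodgeConjecture.Theorems.K2LiuSiegelUnipotentArchPlaces     -- ★ `coe_archAt_eq_map` (brings `archAt`, `archPart`)
import Summits.HodgeConjecture.HodgeConjecture.Theorems.K2LiuHermitianTubeFrameArch        -- ★ `tw_ne_zero` (the frame letters `t_w k ≠ 0`)
import HarnessLib

/-!
# Crux `HLiu418`, socket #41, KIND 1 (K1-b♮) — `K2LiuKindOneLineLeviFrameDictionary`: the `blk ↔ archAt` LEVI DICTIONARY at the tube frames

Cell `hodgecm-mathlib`, hLiu418 = `stmt-HodgeConjecture-24832` (helper lane `--supports … --as helper`, count-neutral), route of record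
`HCCMUnconditional`; squad K2 ∕ K2Liu, socket #41, KIND 1, the (P-dec) block letter `hBL₁′` of ★ `K2LiuKindOneLineDecayOneFrameRate.hdecF₀_of_blockLetter_rate`.

THE POINT.  The payer of `hBL₁′` reads the Levi translate `Λ₀ ĝ` (chart letter `hΛ₀ : blk (Λ₀ g) = R · diag(g, ǧ) · R⁻¹`, `R = cayR`) through an archimedean
frame `(T_w, T_w⁻¹)`: `T_w · (Λ₀ ĝ)_w · T_w⁻¹ = diag(G_w, G_w′)`, and `hBL₁′` spells `G_w` as `σ_w(ĝ)` LITERALLY.  This file computes `G_w`: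
§1 `reindex_archAt_archPart_eq_map` — `blk q = X ⊗ 1 ⟹ (q_w) = σ_w(X)` (entrywise; Mathlib `mixedEmbedding_eq_algebraMap_comp`, `mixedEmbedding_apply_isComplex`);
§2 `tubeFrame_conj_cayley_blockDiag` — in the CLOSED-FORM frame of record (★ `exists_tubeFrame_arch₄` (x): `T = [[D, D], [C, −C]]`, `T⁻¹ = ½[[D⁻¹, C⁻¹], [D⁻¹, −C⁻¹]]`,
`D = diag(√(|t_k|∕2))`, `C = diag(i·sgn t_k·√(|t_k|∕2))`): **`T · (R diag(G, G′) R⁻¹) · T⁻¹ = diag(D G D⁻¹, C G′ C⁻¹)`** — the Levi block is TWISTED by `D` (entry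
`(i,k)` scaled by `√(|t_i|∕|t_k|)`, the twist of KW's framed index ★ `K2LiuKindWArchFramedIndexHermitian`), so it is `σ_w(ĝ)` only when all `|t_k|` agree;
§3 the LEVI-ADAPTED frame `T′ := m(D⁻¹) · T`, `T′⁻¹ := T⁻¹ · m(D)` (`m(D⁻¹) = diag(D⁻¹, D)` is `J`-unitary: `leviScale_conjTranspose_J_mul`, `leviScale_conj_mem_UJ`):
`T′ T′⁻¹ = 1 = T′⁻¹ T′` and **`T′ · (R diag(G, G′) R⁻¹) · T′⁻¹ = diag(G, D C G′ C⁻¹ D⁻¹)`** — Levi block `G` EXACTLY (`tubeFrameAdapted_conj_cayley_blockDiag`);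
§4 the ARCHIMEDEAN READING for every `Λ₀` with the chart letter of record and every `γ ∈ GL_n(L)`: `levi_blk_eq_map`, `reindex_archAt_levi`,
**`frame_archAt_levi_of_record`** (`T_w · (Λ₀ γ)_w · T_w⁻¹ = diag(D σ_w(γ) D⁻¹, …)`), **`frame_archAt_levi_adapted`** (`T′_w · (Λ₀ γ)_w · T′_w⁻¹ = diag(σ_w(γ), …)`).
CONSEQUENCE (K2 bus 2026-09-05T02:52Z): ★ `hdecF₀_of_blockLetter_rate`'s by-value frames `T Tinv` must be keyed to §3's `T′` (then `hBL₁′`'s literal `σ_w(ĝ)` IS the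
Levi block), not to the KW frames of record (there it is `D σ_w(ĝ) D⁻¹`, and the literal letter is unpayable when `|t_0| ≠ |t_1|`).
[HarrisKudlaSweet1996, §1 (1.11)] [Shimura1997, §18.1 (18.4), §A3] [BorelJacquet1979, §4.1] [CasselsFrohlichANT1967, Ch. XV §4.1].
HONEST LABEL.  Count-neutral helper; closes no socket by itself: `HC_CM` is proved only modulo the 7 printed citations (2 remaining named inputs:
hLiu418 = `stmt-HodgeConjecture-24832`, h413 = `stmt-HodgeConjecture-24833`) until rung 0 closes.

## References
* [HarrisKudlaSweet1996] M. Harris, S. S. Kudla, W. J. Sweet, J. Amer. Math. Soc. 9 (1996), §1 (1.11) (the Siegel Levi `m(a)`).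
* [Shimura1997] G. Shimura, CBMS 93 (1997), §18.1 (18.4), §A3.  [BorelJacquet1979] A. Borel, H. Jacquet, PSPM 33.1 (1979), §4.1.  [CasselsFrohlichANT1967] J. Tate, Ch. XV §4.1.
-/

set_option autoImplicit false
set_option linter.dupNamespace false -- the mandated namespace repeats `HodgeConjecture.HodgeConjecture`

noncomputable section

open scoped Matrix ComplexConjugate
open Complex Matrix NumberField NumberField.InfinitePlace IsDedekindDomain
open Literature.NumberTheory.GelbartRogawski1991.AdaptedBlocks Literature.NumberTheory.Automorphic Literature.NumberTheory.Automorphic.UnitaryGroup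
open Literature.NumberTheory.GelbartRogawski1991 Literature.NumberTheory.GelbartRogawski1991.GRConstruction
open UnitaryDualPair

namespace Summit.HodgeConjecture.HodgeConjecture.Cruxes.HLiu418.K2LiuKindOneLineLeviFrameDictionary

open K2LiuSiegelDoubledRationalPoints (map_conj_fromBlocks map_cstar map_nonsing_inv_of_isUnit algebraMap_invOf_two gramRL_facts) open K2LiuHermitianTubeFrameArch (tw_ne_zero)

/-! ## §1 The archimedean component of an element with rational block matrix -/

section ArchReading

variable (L : Type) [Field L] [NumberField L] [IsCMField L]
variable {N M n : ℕ} (e : Fin N × Fin M ≃ Fin n)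
  (dV : Fin N → L) (hdV : ∀ i, IsCMField.complexConj L (dV i) = dV i)
  (dW : Fin M → L) (hdW : ∀ i, IsCMField.complexConj L (dW i) = dW i)

/-- **`(q_w)` read on `Fin n ⊕ Fin n` is `σ_w(X)` when `blk q = X ⊗ 1`** (`X ∈ M_{2n}(L)`; entrywise, ★ `coe_archAt_apply`, the archimedean coordinate of
`x ⊗ 1 ∈ 𝔸_L` is `(σ_v(x))_v`). [cite: BorelJacquet1979, §4.1] [cite: CasselsFrohlichANT1967, Ch. XV §4.1] -/
theorem reindex_archAt_archPart_eq_map (w : {w : InfinitePlace L // w.IsComplex}) (hw : IsCMField.complexConj L • w.1 = w.1)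
    (hc : IsCMField.complexConj L ≠ 1) (q : HA L e dV hdV dW hdW) {X : Matrix (Fin n ⊕ Fin n) (Fin n ⊕ Fin n) L}
    (hq : blk L e dV hdV dW hdW q = X.map (algebraMap L (AdeleRing (𝓞 L) L))) :
    Matrix.reindex (e₂ (n := n)).symm (e₂ (n := n)).symm
        (((UnitaryGroup.archAt (Fp L) L (IsCMField.complexConj L) (n + n) (hermD L e dV hdV dW hdW) w hw hc
            (UnitaryGroup.archPart (Fp L) L (IsCMField.complexConj L) (n + n) (hermD L e dV hdV dW hdW) q) :
            UnitaryGroup.archLocal L (n + n) (hermD L e dV hdV dW hdW) w) : GL (Fin (n + n)) ℂ) : Matrix (Fin (n + n)) (Fin (n + n)) ℂ) =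
      X.map w.1.embedding := by
  ext i j
  have hij := congrFun (congrFun hq i) j
  simp only [Matrix.reindex_apply, Matrix.submatrix_apply, Matrix.map_apply, Equiv.symm_symm] at hij ⊢
  rw [UnitaryGroup.coe_archAt_apply]
  change (InfiniteAdeleRing.ringEquiv_mixedSpace L
      (((((q : HA L e dV hdV dW hdW) : GL (Fin (n + n)) (AdeleRing (𝓞 L) L)) : Matrix (Fin (n + n)) (Fin (n + n)) (AdeleRing (𝓞 L) L))
        ((e₂ (n := n)) i) ((e₂ (n := n)) j)).1)).2 w = _
  rw [hij]
  change (InfiniteAdeleRing.ringEquiv_mixedSpace L (algebraMap L (InfiniteAdeleRing L) (X i j))).2 w = _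
  rw [← InfiniteAdeleRing.mixedEmbedding_eq_algebraMap_comp, NumberField.mixedEmbedding.mixedEmbedding_apply_isComplex]

end ArchReading

/-! ## §2 The Levi block in the closed-form tube frame of record: `T · (R diag(G,G′) R⁻¹) · T⁻¹ = diag(D G D⁻¹, C G′ C⁻¹)` -/

section Frame

variable {ι : Type} [Fintype ι] [DecidableEq ι]

/-- **THE LEVI BLOCK AT THE FRAME OF RECORD** `T = [[D, D], [C, −C]]`, `T⁻¹ = ½[[D⁻¹, C⁻¹], [D⁻¹, −C⁻¹]]` (`D = diag(√(|t_k|∕2))`, `C = diag(i·sgn t_k·√(|t_k|∕2))`,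
★ `exists_tubeFrame_arch₄` (x) BY VALUE): `T · (R · diag(G, G′) · R⁻¹) · T⁻¹ = diag(D G D⁻¹, C G′ C⁻¹)`, spelled with the literal diagonal letters
(`D⁻¹ = diag((√(|t_k|∕2))⁻¹)`, `C⁻¹ = diag(−i·sgn t_k·(√(|t_k|∕2))⁻¹)`). [cite: HarrisKudlaSweet1996, §1 (1.11)] [cite: Shimura1997, §18.1 (18.4), §A3] -/
theorem tubeFrame_conj_cayley_blockDiag (t : ι → ℝ) {T Tinv : Matrix (ι ⊕ ι) (ι ⊕ ι) ℂ}
    (hTdef : T = fromBlocks (diagonal (fun k => (Real.sqrt (|t k| / 2) : ℂ))) (diagonal (fun k => (Real.sqrt (|t k| / 2) : ℂ)))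
        (diagonal (fun k => I * (((t k / |t k|) * Real.sqrt (|t k| / 2) : ℝ) : ℂ))) (-diagonal (fun k => I * (((t k / |t k|) * Real.sqrt (|t k| / 2) : ℝ) : ℂ))))
    (hTinvdef : Tinv = fromBlocks (diagonal (fun k => (((Real.sqrt (|t k| / 2))⁻¹ / 2 : ℝ) : ℂ))) (-diagonal (fun k => I * (((Real.sqrt (|t k| / 2))⁻¹ * (t k / |t k|) / 2 : ℝ) : ℂ)))
        (diagonal (fun k => (((Real.sqrt (|t k| / 2))⁻¹ / 2 : ℝ) : ℂ))) (diagonal (fun k => I * (((Real.sqrt (|t k| / 2))⁻¹ * (t k / |t k|) / 2 : ℝ) : ℂ))))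
    (G G' : Matrix ι ι ℂ) :
    T * (cayR ℂ ι * Matrix.fromBlocks G 0 0 G' * cayRinv ℂ ι) * Tinv =
      Matrix.fromBlocks
        (diagonal (fun k => (Real.sqrt (|t k| / 2) : ℂ)) * G * diagonal (fun k => (((Real.sqrt (|t k| / 2))⁻¹ : ℝ) : ℂ))) 0 0
        (diagonal (fun k => I * (((t k / |t k|) * Real.sqrt (|t k| / 2) : ℝ) : ℂ)) * G' *
          diagonal (fun k => -(I * (((Real.sqrt (|t k| / 2))⁻¹ * (t k / |t k|) : ℝ) : ℂ)))) := by
  set D : Matrix ι ι ℂ := diagonal (fun k => (Real.sqrt (|t k| / 2) : ℂ)) with hD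
  set C : Matrix ι ι ℂ := diagonal (fun k => I * (((t k / |t k|) * Real.sqrt (|t k| / 2) : ℝ) : ℂ)) with hC
  set D' : Matrix ι ι ℂ := diagonal (fun k => (((Real.sqrt (|t k| / 2))⁻¹ / 2 : ℝ) : ℂ)) with hD'
  set C' : Matrix ι ι ℂ := diagonal (fun k => I * (((Real.sqrt (|t k| / 2))⁻¹ * (t k / |t k|) / 2 : ℝ) : ℂ)) with hC'
  have hTR : T * cayR ℂ ι = Matrix.fromBlocks (D + D) 0 0 (C + C) := by
    rw [hTdef, cayR, Matrix.fromBlocks_multiply]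
    simp only [Matrix.mul_one, Matrix.mul_neg, neg_neg]
    congr 1
    · exact add_neg_cancel D
    · exact add_neg_cancel C
  have hRT : cayRinv ℂ ι * Tinv = Matrix.fromBlocks D' 0 0 (-C') := by
    rw [hTinvdef, cayRinv, cayR, Matrix.smul_mul, Matrix.fromBlocks_multiply, Matrix.fromBlocks_smul]
    simp only [Matrix.one_mul, Matrix.neg_mul]
    congr 1
    · rw [← two_smul ℂ D', smul_smul, invOf_mul_self, one_smul]
    · rw [neg_add_cancel, smul_zero]
    · rw [add_neg_cancel, smul_zero]
    · rw [← sub_eq_add_neg, ← neg_add', ← two_smul ℂ C', smul_neg, smul_smul, invOf_mul_self, one_smul]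
  calc T * (cayR ℂ ι * Matrix.fromBlocks G 0 0 G' * cayRinv ℂ ι) * Tinv
      = (T * cayR ℂ ι) * Matrix.fromBlocks G 0 0 G' * (cayRinv ℂ ι * Tinv) := by simp only [Matrix.mul_assoc]
    _ = Matrix.fromBlocks (D + D) 0 0 (C + C) * Matrix.fromBlocks G 0 0 G' * Matrix.fromBlocks D' 0 0 (-C') := by rw [hTR, hRT]
    _ = Matrix.fromBlocks ((D + D) * G * D') 0 0 ((C + C) * G' * (-C')) := by
          rw [Matrix.fromBlocks_multiply, Matrix.fromBlocks_multiply]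
          simp only [Matrix.mul_zero, Matrix.zero_mul, add_zero, zero_add]
    _ = _ := by
          congr 1
          · rw [Matrix.add_mul, Matrix.add_mul, ← Matrix.mul_add, hD', Matrix.diagonal_add]
            congr 2
            funext k
            push_cast
            ring
          · rw [Matrix.add_mul, Matrix.add_mul, ← Matrix.mul_add, hC', Matrix.diagonal_neg, Matrix.diagonal_add]
            congr 2
            funext k
            push_cast
            ring

/-! ## §3 The Levi-ADAPTED frame `T′ = m(D⁻¹) · T`, `T′⁻¹ = T⁻¹ · m(D)` -/

/-- `D⁻¹ · D = 1` for `D = diag(√(|t_k|∕2))`, `t_k ≠ 0`. [cite: Shimura1997, §18.1 (18.4), §A3] -/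
theorem diagSqrtInv_mul_diagSqrt (t : ι → ℝ) (ht : ∀ k, t k ≠ 0) :
    diagonal (fun k => (((Real.sqrt (|t k| / 2))⁻¹ : ℝ) : ℂ)) * diagonal (fun k => (Real.sqrt (|t k| / 2) : ℂ)) = 1 := by
  rw [Matrix.diagonal_mul_diagonal, ← Matrix.diagonal_one]
  congr 1
  ext k
  have hpos : 0 < Real.sqrt (|t k| / 2) := Real.sqrt_pos.2 (div_pos (abs_pos.2 (ht k)) two_pos)
  push_cast
  rw [inv_mul_cancel₀ (by exact_mod_cast hpos.ne')]

/-- `D · D⁻¹ = 1`. [cite: Shimura1997, §18.1 (18.4), §A3] -/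
theorem diagSqrt_mul_diagSqrtInv (t : ι → ℝ) (ht : ∀ k, t k ≠ 0) :
    diagonal (fun k => (Real.sqrt (|t k| / 2) : ℂ)) * diagonal (fun k => (((Real.sqrt (|t k| / 2))⁻¹ : ℝ) : ℂ)) = 1 := by
  rw [Matrix.diagonal_mul_diagonal, ← Matrix.diagonal_one]
  congr 1
  ext k
  have hpos : 0 < Real.sqrt (|t k| / 2) := Real.sqrt_pos.2 (div_pos (abs_pos.2 (ht k)) two_pos)
  push_cast
  rw [mul_inv_cancel₀ (by exact_mod_cast hpos.ne')]

/-- `m(D⁻¹) · m(D) = 1` for `m(D⁻¹) = diag(D⁻¹, D)`, `m(D) = diag(D, D⁻¹)`. [cite: HarrisKudlaSweet1996, §1 (1.11)] -/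
theorem leviScaleInv_mul_leviScale (t : ι → ℝ) (ht : ∀ k, t k ≠ 0) :
    Matrix.fromBlocks (diagonal (fun k => (((Real.sqrt (|t k| / 2))⁻¹ : ℝ) : ℂ))) 0 0 (diagonal (fun k => (Real.sqrt (|t k| / 2) : ℂ))) *
        Matrix.fromBlocks (diagonal (fun k => (Real.sqrt (|t k| / 2) : ℂ))) 0 0 (diagonal (fun k => (((Real.sqrt (|t k| / 2))⁻¹ : ℝ) : ℂ))) = 1 := by
  rw [Matrix.fromBlocks_multiply, diagSqrtInv_mul_diagSqrt t ht, diagSqrt_mul_diagSqrtInv t ht, ← Matrix.fromBlocks_one]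
  simp only [Matrix.mul_zero, Matrix.zero_mul, add_zero, zero_add]

/-- `m(D) · m(D⁻¹) = 1`. [cite: HarrisKudlaSweet1996, §1 (1.11)] -/
theorem leviScale_mul_leviScaleInv (t : ι → ℝ) (ht : ∀ k, t k ≠ 0) :
    Matrix.fromBlocks (diagonal (fun k => (Real.sqrt (|t k| / 2) : ℂ))) 0 0 (diagonal (fun k => (((Real.sqrt (|t k| / 2))⁻¹ : ℝ) : ℂ))) *
        Matrix.fromBlocks (diagonal (fun k => (((Real.sqrt (|t k| / 2))⁻¹ : ℝ) : ℂ))) 0 0 (diagonal (fun k => (Real.sqrt (|t k| / 2) : ℂ))) = 1 := by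
  rw [Matrix.fromBlocks_multiply, diagSqrtInv_mul_diagSqrt t ht, diagSqrt_mul_diagSqrtInv t ht, ← Matrix.fromBlocks_one]
  simp only [Matrix.mul_zero, Matrix.zero_mul, add_zero, zero_add]

/-- **`T′ · T′⁻¹ = 1`** for `T′ := m(D⁻¹) T`, `T′⁻¹ := T⁻¹ m(D)`, from `T T⁻¹ = 1`. [cite: HarrisKudlaSweet1996, §1 (1.11)] -/
theorem tubeFrameAdapted_mul_inv (t : ι → ℝ) (ht : ∀ k, t k ≠ 0) {T Tinv : Matrix (ι ⊕ ι) (ι ⊕ ι) ℂ} (hT : T * Tinv = 1) :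
    (Matrix.fromBlocks (diagonal (fun k => (((Real.sqrt (|t k| / 2))⁻¹ : ℝ) : ℂ))) 0 0 (diagonal (fun k => (Real.sqrt (|t k| / 2) : ℂ))) * T) *
        (Tinv * Matrix.fromBlocks (diagonal (fun k => (Real.sqrt (|t k| / 2) : ℂ))) 0 0 (diagonal (fun k => (((Real.sqrt (|t k| / 2))⁻¹ : ℝ) : ℂ)))) = 1 := by
  rw [Matrix.mul_assoc, ← Matrix.mul_assoc T, hT, Matrix.one_mul, leviScaleInv_mul_leviScale t ht]

/-- **`T′⁻¹ · T′ = 1`** from `T⁻¹ T = 1`. [cite: HarrisKudlaSweet1996, §1 (1.11)] -/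
theorem tubeFrameAdapted_inv_mul (t : ι → ℝ) (ht : ∀ k, t k ≠ 0) {T Tinv : Matrix (ι ⊕ ι) (ι ⊕ ι) ℂ} (hT' : Tinv * T = 1) :
    (Tinv * Matrix.fromBlocks (diagonal (fun k => (Real.sqrt (|t k| / 2) : ℂ))) 0 0 (diagonal (fun k => (((Real.sqrt (|t k| / 2))⁻¹ : ℝ) : ℂ)))) *
        (Matrix.fromBlocks (diagonal (fun k => (((Real.sqrt (|t k| / 2))⁻¹ : ℝ) : ℂ))) 0 0 (diagonal (fun k => (Real.sqrt (|t k| / 2) : ℂ))) * T) = 1 := by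
  rw [Matrix.mul_assoc, ← Matrix.mul_assoc (Matrix.fromBlocks _ _ _ _), leviScale_mul_leviScaleInv t ht, Matrix.one_mul, hT']

/-- `T′ X T′⁻¹ = m(D⁻¹) (T X T⁻¹) m(D)` (associativity): every clause of ★ `exists_tubeFrame_arch₄` transfers along it. [cite: HarrisKudlaSweet1996, §1 (1.11)] -/
theorem tubeFrameAdapted_conj (t : ι → ℝ) (T Tinv X : Matrix (ι ⊕ ι) (ι ⊕ ι) ℂ) :
    (Matrix.fromBlocks (diagonal (fun k => (((Real.sqrt (|t k| / 2))⁻¹ : ℝ) : ℂ))) 0 0 (diagonal (fun k => (Real.sqrt (|t k| / 2) : ℂ))) * T) * X *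
        (Tinv * Matrix.fromBlocks (diagonal (fun k => (Real.sqrt (|t k| / 2) : ℂ))) 0 0 (diagonal (fun k => (((Real.sqrt (|t k| / 2))⁻¹ : ℝ) : ℂ)))) =
      Matrix.fromBlocks (diagonal (fun k => (((Real.sqrt (|t k| / 2))⁻¹ : ℝ) : ℂ))) 0 0 (diagonal (fun k => (Real.sqrt (|t k| / 2) : ℂ))) * (T * X * Tinv) *
        Matrix.fromBlocks (diagonal (fun k => (Real.sqrt (|t k| / 2) : ℂ))) 0 0 (diagonal (fun k => (((Real.sqrt (|t k| / 2))⁻¹ : ℝ) : ℂ))) := by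
  simp only [Matrix.mul_assoc]

/-- **`m(D)` is `J`-unitary**: `m(D)ᴴ · J · m(D) = J` (`D` real diagonal invertible), so the adapted frame still lands in the tube group. [cite: Shimura1997, §18.1 (18.4), §A3] -/
theorem leviScale_conjTranspose_J_mul (t : ι → ℝ) (ht : ∀ k, t k ≠ 0) :
    (Matrix.fromBlocks (diagonal (fun k => (Real.sqrt (|t k| / 2) : ℂ))) 0 0 (diagonal (fun k => (((Real.sqrt (|t k| / 2))⁻¹ : ℝ) : ℂ))))ᴴ *
        Matrix.J ι ℂ *
        Matrix.fromBlocks (diagonal (fun k => (Real.sqrt (|t k| / 2) : ℂ))) 0 0 (diagonal (fun k => (((Real.sqrt (|t k| / 2))⁻¹ : ℝ) : ℂ))) =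
      Matrix.J ι ℂ := by
  have hDs : (diagonal (fun k => (Real.sqrt (|t k| / 2) : ℂ)))ᴴ = diagonal (fun k => (Real.sqrt (|t k| / 2) : ℂ)) := by
    rw [Matrix.diagonal_conjTranspose]; congr 1; ext k; exact Complex.conj_ofReal _
  have hDs' : (diagonal (fun k => (((Real.sqrt (|t k| / 2))⁻¹ : ℝ) : ℂ)))ᴴ = diagonal (fun k => (((Real.sqrt (|t k| / 2))⁻¹ : ℝ) : ℂ)) := by
    rw [Matrix.diagonal_conjTranspose]; congr 1; ext k; exact Complex.conj_ofReal _
  rw [Matrix.fromBlocks_conjTranspose, hDs, hDs', Matrix.J, Matrix.fromBlocks_multiply, Matrix.fromBlocks_multiply]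
  simp only [Matrix.conjTranspose_zero, Matrix.mul_zero, Matrix.zero_mul, add_zero, zero_add, Matrix.mul_one, Matrix.mul_neg, Matrix.neg_mul,
    diagSqrt_mul_diagSqrtInv t ht, diagSqrtInv_mul_diagSqrt t ht, neg_zero]

/-- if `P` is `J`-unitary then so is `m(D⁻¹) P m(D)`. [cite: Shimura1997, §18.1 (18.4), §A3] -/
theorem leviScale_conj_mem_UJ (t : ι → ℝ) (ht : ∀ k, t k ≠ 0) {P : Matrix (ι ⊕ ι) (ι ⊕ ι) ℂ} (hP : Pᴴ * Matrix.J ι ℂ * P = Matrix.J ι ℂ) :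
    (Matrix.fromBlocks (diagonal (fun k => (((Real.sqrt (|t k| / 2))⁻¹ : ℝ) : ℂ))) 0 0 (diagonal (fun k => (Real.sqrt (|t k| / 2) : ℂ))) * P *
        Matrix.fromBlocks (diagonal (fun k => (Real.sqrt (|t k| / 2) : ℂ))) 0 0 (diagonal (fun k => (((Real.sqrt (|t k| / 2))⁻¹ : ℝ) : ℂ))))ᴴ *
        Matrix.J ι ℂ *
        (Matrix.fromBlocks (diagonal (fun k => (((Real.sqrt (|t k| / 2))⁻¹ : ℝ) : ℂ))) 0 0 (diagonal (fun k => (Real.sqrt (|t k| / 2) : ℂ))) * P *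
          Matrix.fromBlocks (diagonal (fun k => (Real.sqrt (|t k| / 2) : ℂ))) 0 0 (diagonal (fun k => (((Real.sqrt (|t k| / 2))⁻¹ : ℝ) : ℂ)))) =
      Matrix.J ι ℂ := by
  set mD := Matrix.fromBlocks (diagonal (fun k => (Real.sqrt (|t k| / 2) : ℂ))) 0 0 (diagonal (fun k => (((Real.sqrt (|t k| / 2))⁻¹ : ℝ) : ℂ)))
  set mD' := Matrix.fromBlocks (diagonal (fun k => (((Real.sqrt (|t k| / 2))⁻¹ : ℝ) : ℂ))) 0 0 (diagonal (fun k => (Real.sqrt (|t k| / 2) : ℂ)))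
  have hJ : mDᴴ * Matrix.J ι ℂ * mD = Matrix.J ι ℂ := leviScale_conjTranspose_J_mul t ht
  have h1 : mD * mD' = 1 := leviScale_mul_leviScaleInv t ht
  have h1s : mD'ᴴ * mDᴴ = 1 := by rw [← Matrix.conjTranspose_mul, h1, Matrix.conjTranspose_one]
  have hJ' : mD'ᴴ * Matrix.J ι ℂ * mD' = Matrix.J ι ℂ := by
    calc mD'ᴴ * Matrix.J ι ℂ * mD' = mD'ᴴ * (mDᴴ * Matrix.J ι ℂ * mD) * mD' := by rw [hJ]
      _ = (mD'ᴴ * mDᴴ) * Matrix.J ι ℂ * (mD * mD') := by simp only [Matrix.mul_assoc]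
      _ = Matrix.J ι ℂ := by rw [h1s, h1, Matrix.one_mul, Matrix.mul_one]
  rw [Matrix.conjTranspose_mul, Matrix.conjTranspose_mul]
  calc mDᴴ * (Pᴴ * mD'ᴴ) * Matrix.J ι ℂ * (mD' * P * mD) = mDᴴ * (Pᴴ * (mD'ᴴ * Matrix.J ι ℂ * mD') * P) * mD := by
        simp only [Matrix.mul_assoc]
    _ = Matrix.J ι ℂ := by rw [hJ', hP, hJ]

/-- **THE LEVI BLOCK AT THE ADAPTED FRAME IS `G`**: `T′ · (R diag(G, G′) R⁻¹) · T′⁻¹ = diag(G, D C G′ C⁻¹ D⁻¹)`. [cite: HarrisKudlaSweet1996, §1 (1.11)] -/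
theorem tubeFrameAdapted_conj_cayley_blockDiag (t : ι → ℝ) (ht : ∀ k, t k ≠ 0) {T Tinv : Matrix (ι ⊕ ι) (ι ⊕ ι) ℂ}
    (hTdef : T = fromBlocks (diagonal (fun k => (Real.sqrt (|t k| / 2) : ℂ))) (diagonal (fun k => (Real.sqrt (|t k| / 2) : ℂ)))
        (diagonal (fun k => I * (((t k / |t k|) * Real.sqrt (|t k| / 2) : ℝ) : ℂ))) (-diagonal (fun k => I * (((t k / |t k|) * Real.sqrt (|t k| / 2) : ℝ) : ℂ))))
    (hTinvdef : Tinv = fromBlocks (diagonal (fun k => (((Real.sqrt (|t k| / 2))⁻¹ / 2 : ℝ) : ℂ))) (-diagonal (fun k => I * (((Real.sqrt (|t k| / 2))⁻¹ * (t k / |t k|) / 2 : ℝ) : ℂ)))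
        (diagonal (fun k => (((Real.sqrt (|t k| / 2))⁻¹ / 2 : ℝ) : ℂ))) (diagonal (fun k => I * (((Real.sqrt (|t k| / 2))⁻¹ * (t k / |t k|) / 2 : ℝ) : ℂ))))
    (G G' : Matrix ι ι ℂ) :
    (Matrix.fromBlocks (diagonal (fun k => (((Real.sqrt (|t k| / 2))⁻¹ : ℝ) : ℂ))) 0 0 (diagonal (fun k => (Real.sqrt (|t k| / 2) : ℂ))) * T) *
        (cayR ℂ ι * Matrix.fromBlocks G 0 0 G' * cayRinv ℂ ι) *
        (Tinv * Matrix.fromBlocks (diagonal (fun k => (Real.sqrt (|t k| / 2) : ℂ))) 0 0 (diagonal (fun k => (((Real.sqrt (|t k| / 2))⁻¹ : ℝ) : ℂ)))) =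
      Matrix.fromBlocks G 0 0
        (diagonal (fun k => (Real.sqrt (|t k| / 2) : ℂ)) *
          (diagonal (fun k => I * (((t k / |t k|) * Real.sqrt (|t k| / 2) : ℝ) : ℂ)) * G' *
            diagonal (fun k => -(I * (((Real.sqrt (|t k| / 2))⁻¹ * (t k / |t k|) : ℝ) : ℂ)))) *
          diagonal (fun k => (((Real.sqrt (|t k| / 2))⁻¹ : ℝ) : ℂ))) := by
  rw [tubeFrameAdapted_conj, tubeFrame_conj_cayley_blockDiag t hTdef hTinvdef G G', Matrix.fromBlocks_multiply, Matrix.fromBlocks_multiply]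
  simp only [Matrix.mul_zero, Matrix.zero_mul, add_zero, zero_add]
  congr 1
  rw [← Matrix.mul_assoc, ← Matrix.mul_assoc, diagSqrtInv_mul_diagSqrt t ht, Matrix.one_mul, Matrix.mul_assoc, diagSqrtInv_mul_diagSqrt t ht,
    Matrix.mul_one]

end Frame

/-! ## §4 The archimedean reading of the Levi translate `Λ₀ γ` -/

section Levi

variable (L : Type) [Field L] [NumberField L] [IsCMField L]
variable {N M n : ℕ} (e : Fin N × Fin M ≃ Fin n)
  (dV : Fin N → L) (hdV : ∀ i, IsCMField.complexConj L (dV i) = dV i)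
  (dW : Fin M → L) (hdW : ∀ i, IsCMField.complexConj L (dW i) = dW i)

/-- **the chart letter's right side at `g = γ ⊗ 1` IS `(R · diag(γ, γ̌) · R⁻¹) ⊗ 1`**, `γ̌ = T_L⁻¹ (c γ⁻¹)ᵀ T_L` (★ `map_conj_fromBlocks` &c.). [cite: HarrisKudlaSweet1996, §1 (1.11)] -/
theorem levi_blk_eq_map (hdV0 : ∀ i, dV i ≠ 0) (hdW0 : ∀ i, dW i ≠ 0) (γ : GL (Fin n) L) :
    cayR (AdeleRing (𝓞 L) L) (Fin n) *
        Matrix.fromBlocks ((Matrix.GeneralLinearGroup.map (algebraMap L (AdeleRing (𝓞 L) L)) γ : GL (Fin n) (AdeleRing (𝓞 L) L)) :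
            Matrix (Fin n) (Fin n) (AdeleRing (𝓞 L) L)) 0 0
          (((gramR L e dV hdV dW hdW).map ((algebraMap L (AdeleRing (𝓞 L) L)).comp (algebraMap (Fp L) L)))⁻¹ *
            ((((Matrix.GeneralLinearGroup.map (algebraMap L (AdeleRing (𝓞 L) L)) γ)⁻¹ : GL (Fin n) (AdeleRing (𝓞 L) L)) :
                Matrix (Fin n) (Fin n) (AdeleRing (𝓞 L) L)).map (conjAdele (Fp L) L (IsCMField.complexConj L)))ᵀ *
            (gramR L e dV hdV dW hdW).map ((algebraMap L (AdeleRing (𝓞 L) L)).comp (algebraMap (Fp L) L))) *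
        cayRinv (AdeleRing (𝓞 L) L) (Fin n) =
      (cayR L (Fin n) *
          Matrix.fromBlocks (γ : Matrix (Fin n) (Fin n) L) 0 0
            (((gramR L e dV hdV dW hdW).map (algebraMap (Fp L) L))⁻¹ *
              ((((γ⁻¹ : GL (Fin n) L)) : Matrix (Fin n) (Fin n) L).map ((IsCMField.complexConj L : L ≃ₐ[Fp L] L) : L →+* L))ᵀ *
              (gramR L e dV hdV dW hdW).map (algebraMap (Fp L) L)) *
          cayRinv L (Fin n)).map (algebraMap L (AdeleRing (𝓞 L) L)) := by
  obtain ⟨hT, -, -, hTA⟩ := gramRL_facts L e dV hdV dW hdW hdV0 hdW0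
  have hfc : ∀ x, algebraMap L (AdeleRing (𝓞 L) L) (((IsCMField.complexConj L : L ≃ₐ[Fp L] L) : L →+* L) x) =
      conjAdele (Fp L) L (IsCMField.complexConj L) (algebraMap L (AdeleRing (𝓞 L) L) x) := fun x => algebraMap_conj (Fp L) L _ x
  rw [map_conj_fromBlocks (algebraMap L (AdeleRing (𝓞 L) L)) (algebraMap_invOf_two L), Matrix.map_zero _ (map_zero _), Matrix.map_mul,
    Matrix.map_mul, map_nonsing_inv_of_isUnit (algebraMap L (AdeleRing (𝓞 L) L)) hT, hTA, map_cstar (algebraMap L (AdeleRing (𝓞 L) L)) hfc]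
  rfl

variable (hdV0 : ∀ i, dV i ≠ 0) (hdW0 : ∀ i, dW i ≠ 0)
  (Λ₀ : GL (Fin n) (AdeleRing (𝓞 L) L) →* HA L e dV hdV dW hdW)
  (hΛ₀ : ∀ g : GL (Fin n) (AdeleRing (𝓞 L) L), blk L e dV hdV dW hdW (Λ₀ g) =
    cayR (AdeleRing (𝓞 L) L) (Fin n) * Matrix.fromBlocks (g : Matrix (Fin n) (Fin n) (AdeleRing (𝓞 L) L)) 0 0
      (((gramR L e dV hdV dW hdW).map ((algebraMap L (AdeleRing (𝓞 L) L)).comp (algebraMap (Fp L) L)))⁻¹ *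
        (((g⁻¹ : GL (Fin n) (AdeleRing (𝓞 L) L)) : Matrix (Fin n) (Fin n) (AdeleRing (𝓞 L) L)).map
          (conjAdele (Fp L) L (IsCMField.complexConj L)))ᵀ *
        (gramR L e dV hdV dW hdW).map ((algebraMap L (AdeleRing (𝓞 L) L)).comp (algebraMap (Fp L) L))) *
      cayRinv (AdeleRing (𝓞 L) L) (Fin n))
  (w : {w : InfinitePlace L // w.IsComplex}) (hw : IsCMField.complexConj L • w.1 = w.1) (hc : IsCMField.complexConj L ≠ 1)

include hdV0 hdW0 hΛ₀ in
/-- **`(Λ₀ γ)_w = R · diag(σ_w(γ), σ_w(γ̌)) · R⁻¹`** on `Fin n ⊕ Fin n` (§1 on `levi_blk_eq_map`). [cite: HarrisKudlaSweet1996, §1 (1.11)] [cite: BorelJacquet1979, §4.1] -/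
theorem reindex_archAt_levi (γ : GL (Fin n) L) :
    Matrix.reindex (e₂ (n := n)).symm (e₂ (n := n)).symm
        (((UnitaryGroup.archAt (Fp L) L (IsCMField.complexConj L) (n + n) (hermD L e dV hdV dW hdW) w hw hc
            (UnitaryGroup.archPart (Fp L) L (IsCMField.complexConj L) (n + n) (hermD L e dV hdV dW hdW)
              (Λ₀ (Matrix.GeneralLinearGroup.map (algebraMap L (AdeleRing (𝓞 L) L)) γ))) :
            UnitaryGroup.archLocal L (n + n) (hermD L e dV hdV dW hdW) w) : GL (Fin (n + n)) ℂ) : Matrix (Fin (n + n)) (Fin (n + n)) ℂ) =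
      cayR ℂ (Fin n) *
        Matrix.fromBlocks ((γ : Matrix (Fin n) (Fin n) L).map w.1.embedding) 0 0
          ((((gramR L e dV hdV dW hdW).map (algebraMap (Fp L) L))⁻¹ *
              ((((γ⁻¹ : GL (Fin n) L)) : Matrix (Fin n) (Fin n) L).map ((IsCMField.complexConj L : L ≃ₐ[Fp L] L) : L →+* L))ᵀ *
              (gramR L e dV hdV dW hdW).map (algebraMap (Fp L) L)).map w.1.embedding) *
        cayRinv ℂ (Fin n) := by
  have hq := hΛ₀ (Matrix.GeneralLinearGroup.map (algebraMap L (AdeleRing (𝓞 L) L)) γ)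
  rw [levi_blk_eq_map L e dV hdV dW hdW hdV0 hdW0 γ] at hq
  rw [reindex_archAt_archPart_eq_map L e dV hdV dW hdW w hw hc _ hq,
    map_conj_fromBlocks w.1.embedding (by rw [invOf_eq_inv, invOf_eq_inv, map_inv₀, map_ofNat]), Matrix.map_zero _ (map_zero _)]

include hdV0 hdW0 hΛ₀ in
/-- **THE LEVI BLOCK OF `Λ₀ γ` AT THE FRAME OF RECORD**: with `hTdef hTinvdef` the closed forms of ★ `exists_tubeFrame_arch₄` (x) at the place `w`
(`t_w k = Re σ_w(dV dW)`): `T_w · (Λ₀ γ)_w · T_w⁻¹ = diag(D_w σ_w(γ) D_w⁻¹, C_w σ_w(γ̌) C_w⁻¹)`. [cite: HarrisKudlaSweet1996, §1 (1.11)] [cite: Shimura1997, §18.1 (18.4), §A3] -/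
theorem frame_archAt_levi_of_record {T Tinv : Matrix (Fin n ⊕ Fin n) (Fin n ⊕ Fin n) ℂ}
    (hTdef : T = fromBlocks (diagonal (fun k => (Real.sqrt (|(w.1.embedding (dV (e.symm k).1 * dW (e.symm k).2)).re| / 2) : ℂ)))
        (diagonal (fun k => (Real.sqrt (|(w.1.embedding (dV (e.symm k).1 * dW (e.symm k).2)).re| / 2) : ℂ)))
        (diagonal (fun k => I * ((((w.1.embedding (dV (e.symm k).1 * dW (e.symm k).2)).re / |(w.1.embedding (dV (e.symm k).1 * dW (e.symm k).2)).re|) *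
          Real.sqrt (|(w.1.embedding (dV (e.symm k).1 * dW (e.symm k).2)).re| / 2) : ℝ) : ℂ)))
        (-diagonal (fun k => I * ((((w.1.embedding (dV (e.symm k).1 * dW (e.symm k).2)).re / |(w.1.embedding (dV (e.symm k).1 * dW (e.symm k).2)).re|) *
          Real.sqrt (|(w.1.embedding (dV (e.symm k).1 * dW (e.symm k).2)).re| / 2) : ℝ) : ℂ))))
    (hTinvdef : Tinv = fromBlocks (diagonal (fun k => (((Real.sqrt (|(w.1.embedding (dV (e.symm k).1 * dW (e.symm k).2)).re| / 2))⁻¹ / 2 : ℝ) : ℂ)))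
        (-diagonal (fun k => I * (((Real.sqrt (|(w.1.embedding (dV (e.symm k).1 * dW (e.symm k).2)).re| / 2))⁻¹ *
          ((w.1.embedding (dV (e.symm k).1 * dW (e.symm k).2)).re / |(w.1.embedding (dV (e.symm k).1 * dW (e.symm k).2)).re|) / 2 : ℝ) : ℂ)))
        (diagonal (fun k => (((Real.sqrt (|(w.1.embedding (dV (e.symm k).1 * dW (e.symm k).2)).re| / 2))⁻¹ / 2 : ℝ) : ℂ)))
        (diagonal (fun k => I * (((Real.sqrt (|(w.1.embedding (dV (e.symm k).1 * dW (e.symm k).2)).re| / 2))⁻¹ *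
          ((w.1.embedding (dV (e.symm k).1 * dW (e.symm k).2)).re / |(w.1.embedding (dV (e.symm k).1 * dW (e.symm k).2)).re|) / 2 : ℝ) : ℂ))))
    (γ : GL (Fin n) L) :
    T * Matrix.reindex (e₂ (n := n)).symm (e₂ (n := n)).symm
        (((UnitaryGroup.archAt (Fp L) L (IsCMField.complexConj L) (n + n) (hermD L e dV hdV dW hdW) w hw hc
            (UnitaryGroup.archPart (Fp L) L (IsCMField.complexConj L) (n + n) (hermD L e dV hdV dW hdW)
              (Λ₀ (Matrix.GeneralLinearGroup.map (algebraMap L (AdeleRing (𝓞 L) L)) γ))) :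
            UnitaryGroup.archLocal L (n + n) (hermD L e dV hdV dW hdW) w) : GL (Fin (n + n)) ℂ) : Matrix (Fin (n + n)) (Fin (n + n)) ℂ) * Tinv =
      Matrix.fromBlocks
        (diagonal (fun k => (Real.sqrt (|(w.1.embedding (dV (e.symm k).1 * dW (e.symm k).2)).re| / 2) : ℂ)) *
          (γ : Matrix (Fin n) (Fin n) L).map w.1.embedding *
          diagonal (fun k => (((Real.sqrt (|(w.1.embedding (dV (e.symm k).1 * dW (e.symm k).2)).re| / 2))⁻¹ : ℝ) : ℂ))) 0 0
        (diagonal (fun k => I * ((((w.1.embedding (dV (e.symm k).1 * dW (e.symm k).2)).re / |(w.1.embedding (dV (e.symm k).1 * dW (e.symm k).2)).re|) *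
            Real.sqrt (|(w.1.embedding (dV (e.symm k).1 * dW (e.symm k).2)).re| / 2) : ℝ) : ℂ)) *
          (((gramR L e dV hdV dW hdW).map (algebraMap (Fp L) L))⁻¹ *
              ((((γ⁻¹ : GL (Fin n) L)) : Matrix (Fin n) (Fin n) L).map ((IsCMField.complexConj L : L ≃ₐ[Fp L] L) : L →+* L))ᵀ *
              (gramR L e dV hdV dW hdW).map (algebraMap (Fp L) L)).map w.1.embedding *
          diagonal (fun k => -(I * (((Real.sqrt (|(w.1.embedding (dV (e.symm k).1 * dW (e.symm k).2)).re| / 2))⁻¹ *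
            ((w.1.embedding (dV (e.symm k).1 * dW (e.symm k).2)).re / |(w.1.embedding (dV (e.symm k).1 * dW (e.symm k).2)).re|) : ℝ) : ℂ)))) := by
  rw [reindex_archAt_levi L e dV hdV dW hdW hdV0 hdW0 Λ₀ hΛ₀ w hw hc γ]
  exact tubeFrame_conj_cayley_blockDiag (fun k => (w.1.embedding (dV (e.symm k).1 * dW (e.symm k).2)).re) hTdef hTinvdef _ _

include hdV0 hdW0 hΛ₀ in
/-- **THE LEVI BLOCK OF `Λ₀ γ` AT THE ADAPTED FRAME IS `σ_w(γ)` EXACTLY**: `T′_w · (Λ₀ γ)_w · T′_w⁻¹ = diag(σ_w(γ), …)` for `T′_w := m(D_w⁻¹) T_w`,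
`T′_w⁻¹ := T_w⁻¹ m(D_w)` — where ★ `hdecF₀_of_blockLetter_rate`'s literal `σ_w(ĝ)` IS the Levi block. [cite: HarrisKudlaSweet1996, §1 (1.11)] -/
theorem frame_archAt_levi_adapted {T Tinv : Matrix (Fin n ⊕ Fin n) (Fin n ⊕ Fin n) ℂ}
    (hTdef : T = fromBlocks (diagonal (fun k => (Real.sqrt (|(w.1.embedding (dV (e.symm k).1 * dW (e.symm k).2)).re| / 2) : ℂ)))
        (diagonal (fun k => (Real.sqrt (|(w.1.embedding (dV (e.symm k).1 * dW (e.symm k).2)).re| / 2) : ℂ)))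
        (diagonal (fun k => I * ((((w.1.embedding (dV (e.symm k).1 * dW (e.symm k).2)).re / |(w.1.embedding (dV (e.symm k).1 * dW (e.symm k).2)).re|) *
          Real.sqrt (|(w.1.embedding (dV (e.symm k).1 * dW (e.symm k).2)).re| / 2) : ℝ) : ℂ)))
        (-diagonal (fun k => I * ((((w.1.embedding (dV (e.symm k).1 * dW (e.symm k).2)).re / |(w.1.embedding (dV (e.symm k).1 * dW (e.symm k).2)).re|) *
          Real.sqrt (|(w.1.embedding (dV (e.symm k).1 * dW (e.symm k).2)).re| / 2) : ℝ) : ℂ))))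
    (hTinvdef : Tinv = fromBlocks (diagonal (fun k => (((Real.sqrt (|(w.1.embedding (dV (e.symm k).1 * dW (e.symm k).2)).re| / 2))⁻¹ / 2 : ℝ) : ℂ)))
        (-diagonal (fun k => I * (((Real.sqrt (|(w.1.embedding (dV (e.symm k).1 * dW (e.symm k).2)).re| / 2))⁻¹ *
          ((w.1.embedding (dV (e.symm k).1 * dW (e.symm k).2)).re / |(w.1.embedding (dV (e.symm k).1 * dW (e.symm k).2)).re|) / 2 : ℝ) : ℂ)))
        (diagonal (fun k => (((Real.sqrt (|(w.1.embedding (dV (e.symm k).1 * dW (e.symm k).2)).re| / 2))⁻¹ / 2 : ℝ) : ℂ)))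
        (diagonal (fun k => I * (((Real.sqrt (|(w.1.embedding (dV (e.symm k).1 * dW (e.symm k).2)).re| / 2))⁻¹ *
          ((w.1.embedding (dV (e.symm k).1 * dW (e.symm k).2)).re / |(w.1.embedding (dV (e.symm k).1 * dW (e.symm k).2)).re|) / 2 : ℝ) : ℂ))))
    (γ : GL (Fin n) L) :
    (Matrix.fromBlocks (diagonal (fun k => (((Real.sqrt (|(w.1.embedding (dV (e.symm k).1 * dW (e.symm k).2)).re| / 2))⁻¹ : ℝ) : ℂ))) 0 0
          (diagonal (fun k => (Real.sqrt (|(w.1.embedding (dV (e.symm k).1 * dW (e.symm k).2)).re| / 2) : ℂ))) * T) *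
        Matrix.reindex (e₂ (n := n)).symm (e₂ (n := n)).symm
          (((UnitaryGroup.archAt (Fp L) L (IsCMField.complexConj L) (n + n) (hermD L e dV hdV dW hdW) w hw hc
              (UnitaryGroup.archPart (Fp L) L (IsCMField.complexConj L) (n + n) (hermD L e dV hdV dW hdW)
                (Λ₀ (Matrix.GeneralLinearGroup.map (algebraMap L (AdeleRing (𝓞 L) L)) γ))) :
              UnitaryGroup.archLocal L (n + n) (hermD L e dV hdV dW hdW) w) : GL (Fin (n + n)) ℂ) : Matrix (Fin (n + n)) (Fin (n + n)) ℂ) *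
        (Tinv * Matrix.fromBlocks (diagonal (fun k => (Real.sqrt (|(w.1.embedding (dV (e.symm k).1 * dW (e.symm k).2)).re| / 2) : ℂ))) 0 0
          (diagonal (fun k => (((Real.sqrt (|(w.1.embedding (dV (e.symm k).1 * dW (e.symm k).2)).re| / 2))⁻¹ : ℝ) : ℂ)))) =
      Matrix.fromBlocks ((γ : Matrix (Fin n) (Fin n) L).map w.1.embedding) 0 0
        (diagonal (fun k => (Real.sqrt (|(w.1.embedding (dV (e.symm k).1 * dW (e.symm k).2)).re| / 2) : ℂ)) *
          (diagonal (fun k => I * ((((w.1.embedding (dV (e.symm k).1 * dW (e.symm k).2)).re / |(w.1.embedding (dV (e.symm k).1 * dW (e.symm k).2)).re|) *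
              Real.sqrt (|(w.1.embedding (dV (e.symm k).1 * dW (e.symm k).2)).re| / 2) : ℝ) : ℂ)) *
            (((gramR L e dV hdV dW hdW).map (algebraMap (Fp L) L))⁻¹ *
                ((((γ⁻¹ : GL (Fin n) L)) : Matrix (Fin n) (Fin n) L).map ((IsCMField.complexConj L : L ≃ₐ[Fp L] L) : L →+* L))ᵀ *
                (gramR L e dV hdV dW hdW).map (algebraMap (Fp L) L)).map w.1.embedding *
            diagonal (fun k => -(I * (((Real.sqrt (|(w.1.embedding (dV (e.symm k).1 * dW (e.symm k).2)).re| / 2))⁻¹ *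
              ((w.1.embedding (dV (e.symm k).1 * dW (e.symm k).2)).re / |(w.1.embedding (dV (e.symm k).1 * dW (e.symm k).2)).re|) : ℝ) : ℂ)))) *
          diagonal (fun k => (((Real.sqrt (|(w.1.embedding (dV (e.symm k).1 * dW (e.symm k).2)).re| / 2))⁻¹ : ℝ) : ℂ))) := by
  rw [reindex_archAt_levi L e dV hdV dW hdW hdV0 hdW0 Λ₀ hΛ₀ w hw hc γ]
  exact tubeFrameAdapted_conj_cayley_blockDiag (fun k => (w.1.embedding (dV (e.symm k).1 * dW (e.symm k).2)).re)
    (tw_ne_zero L e dV hdV dW hdW w hw hdV0 hdW0) hTdef hTinvdef _ _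

end Levi

end Summit.HodgeConjecture.HodgeConjecture.Cruxes.HLiu418.K2LiuKindOneLineLeviFrameDictionary

end
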